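import Mathlib

/-!
# PER-LAYER DOMINANCE IS PRESERVED BY ADDING A COLOOP OR A PARALLEL POINT — THE ARITHMETIC (night-3 g29)

`proofs/NIGHT3-G29-PARALLEL.md` §4.  PER-LAYER DOMINANCE (the hypothesis of the landed bridge
`PLDBridge.rls_disjointSum_freeOn_of_pld`) is a statement about the multiset of pairs `(x, f) = (ρ(I), ρ(E ∖ I))`,
`I ⊆ E` — here an arbitrary finite family `s` with functions `x f : ι → ℕ`:
  (PLD)  ∀ lo hi δ Θ, Θ ≤ lo+hi+δ → (lo = 0 ∨ lo+hi+δ ≤ Θ) →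
         Σ_{i∈s} [lo ≤ x i ≤ hi ∧ Θ ≤ f i + x i]·C(f i, δ)  ≤  Σ_{i∈s} [lo+δ ≤ f i ≤ hi+δ]·C(f i, δ).
Adding a coloop `e` to a matroid sends each `I` to the two sets `I` (pair `(x, f+1)`) and `I ∪ {e}` (pair `(x+1, f)`);
adding a point parallel to an existing one contributes the pairs `(x+1, f+1)` (sets containing some but not all of a
parallel class).  The three lemmas say that (PLD) survives each: `shift10` — the pairs `(x+1, f)` satisfy the (PLD)
inequality at `(lo, hi, δ, Θ)` by ONE instance of (PLD) at level `δ+1` (window `[lo−1, hi−1]`, threshold `Θ−1`),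
termwise through `(δ+1)·C(f, δ+1) = (f−δ)·C(f, δ)` (the multiplier `(δ+1)/(hi+1)` of the linear-programming
certificate); `shift11` — the pairs `(x+1, f+1)`, by the matched instance at `(lo−1, hi−1, δ, Θ−2)` and `shift10` at
level `δ−1` (Pascal); `coloop` — the pairs `(x, f+1)` and `(x+1, f)` together, by the inclusion–exclusion of two
equal-length windows (`[lo−1, hi−1] + [lo, hi] = [lo−1, hi] + [lo, hi−1]`) and the instances `(lo−1, hi, δ, Θ−1)`,
`(lo, hi−1, δ, Θ−1)`, `(lo, hi, δ−1, Θ−1)`.  The matroid module assembles them into (PLD) for `M ⊕ (parallel classes)`.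
No `def`, no `instance`, no notation.  Axioms: standard.
-/

namespace PercRepro

open Finset

namespace PLDClosure

variable {ι : Type}

/-- `(δ+1)·C(f, δ+1) + δ·C(f, δ) = f·C(f, δ)`, the subtraction-free form of `(δ+1)·C(f, δ+1) = (f−δ)·C(f, δ)`. -/
theorem succ_mul_choose_succ (f δ : ℕ) : (δ + 1) * f.choose (δ + 1) + δ * f.choose δ = f * f.choose δ := by
  have h := Nat.choose_succ_right_eq f δ
  rcases le_or_gt δ f with hδ | hδ
  · have e : f - δ + δ = f := Nat.sub_add_cancel hδ
    calc (δ + 1) * f.choose (δ + 1) + δ * f.choose δ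
        = f.choose δ * (f - δ) + δ * f.choose δ := by rw [mul_comm, h]
      _ = (f - δ + δ) * f.choose δ := by ring
      _ = f * f.choose δ := by rw [e]
  · rw [Nat.choose_eq_zero_of_lt hδ, Nat.choose_eq_zero_of_lt (by omega)]
    simp

/-- THE (1,0)-SHIFT: if the family `(x, f)` satisfies (PLD) then the family `(x+1, f)` satisfies the (PLD) inequality at
every admissible `(lo, hi, δ, Θ)` — from the single instance `(lo−1, hi−1, δ+1, Θ−1)` with multiplier `(δ+1)/(hi+1)`. -/
theorem shift10 (s : Finset ι) (x f : ι → ℕ)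
    (h : ∀ lo hi δ Θ : ℕ, Θ ≤ lo + hi + δ → (lo = 0 ∨ lo + hi + δ ≤ Θ) →
      ∑ i ∈ s, (if lo ≤ x i ∧ x i ≤ hi ∧ Θ ≤ f i + x i then (f i).choose δ else 0) ≤
        ∑ i ∈ s, (if lo + δ ≤ f i ∧ f i ≤ hi + δ then (f i).choose δ else 0))
    (lo hi δ Θ : ℕ) (hΘ : Θ ≤ lo + hi + δ) (hlo : lo = 0 ∨ lo + hi + δ ≤ Θ) :
    ∑ i ∈ s, (if lo ≤ x i + 1 ∧ x i + 1 ≤ hi ∧ Θ ≤ f i + (x i + 1) then (f i).choose δ else 0) ≤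
      ∑ i ∈ s, (if lo + δ ≤ f i ∧ f i ≤ hi + δ then (f i).choose δ else 0) := by
  rcases Nat.eq_zero_or_pos lo with hlo0 | hlopos
  · -- `lo = 0`: the instance `(0, hi, δ, 0)` dominates termwise
    subst hlo0
    refine le_trans (Finset.sum_le_sum fun i _ => ?_) (h 0 hi δ 0 (Nat.zero_le _) (Or.inl rfl))
    by_cases hA : 0 ≤ x i + 1 ∧ x i + 1 ≤ hi ∧ Θ ≤ f i + (x i + 1)
    · rw [if_pos hA, if_pos ⟨Nat.zero_le _, by omega, Nat.zero_le _⟩]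
    · rw [if_neg hA]; exact Nat.zero_le _
  · -- `lo ≥ 1`, hence `Θ = lo + hi + δ`
    have hlo1 : lo + hi + δ ≤ Θ := by
      rcases hlo with h0 | h1
      · omega
      · exact h1
    have hΘe : Θ = lo + hi + δ := le_antisymm hΘ hlo1
    subst hΘe
    rcases Nat.lt_or_ge hi lo with hhl | hhl
    · -- the left window is empty
      refine le_trans (le_of_eq (Finset.sum_eq_zero fun i _ => ?_)) (Nat.zero_le _)
      rw [if_neg (by omega)]
    obtain ⟨l, rfl⟩ : ∃ l, lo = l + 1 := ⟨lo - 1, by omega⟩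
    obtain ⟨h', rfl⟩ : ∃ h', hi = h' + 1 := ⟨hi - 1, by omega⟩
    -- the instance `(l, h', δ+1, l + h' + (δ+1))`
    have hi' := h l h' (δ + 1) (l + h' + (δ + 1)) le_rfl (Or.inr le_rfl)
    -- the termwise inequality `(hi+1)·R_t + (δ+1)·L_i ≥ (hi+1)·L_t + (δ+1)·R_i`
    have hterm : ∀ i ∈ s,
        (h' + 1 + 1) * (if l + 1 ≤ x i + 1 ∧ x i + 1 ≤ h' + 1 ∧ l + 1 + (h' + 1) + δ ≤ f i + (x i + 1) then
            (f i).choose δ else 0) +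
          (δ + 1) * (if l + (δ + 1) ≤ f i ∧ f i ≤ h' + (δ + 1) then (f i).choose (δ + 1) else 0) ≤
        (h' + 1 + 1) * (if l + 1 + δ ≤ f i ∧ f i ≤ h' + 1 + δ then (f i).choose δ else 0) +
          (δ + 1) * (if l ≤ x i ∧ x i ≤ h' ∧ l + h' + (δ + 1) ≤ f i + x i then (f i).choose (δ + 1) else 0) := by
      intro i _
      have key := succ_mul_choose_succ (f i) δ
      by_cases hA : l + 1 ≤ x i + 1 ∧ x i + 1 ≤ h' + 1 ∧ l + 1 + (h' + 1) + δ ≤ f i + (x i + 1)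
      · have hA' : l ≤ x i ∧ x i ≤ h' ∧ l + h' + (δ + 1) ≤ f i + x i := by omega
        rw [if_pos hA, if_pos hA']
        by_cases hB : l + (δ + 1) ≤ f i ∧ f i ≤ h' + (δ + 1)
        · have hB' : l + 1 + δ ≤ f i ∧ f i ≤ h' + 1 + δ := by omega
          rw [if_pos hB, if_pos hB']
        · have hB' : ¬ (l + 1 + δ ≤ f i ∧ f i ≤ h' + 1 + δ) := by omega
          rw [if_neg hB, if_neg hB', mul_zero, mul_zero, zero_add, add_zero]
          -- here `f i ≥ h' + δ + 2`, so `(δ+1)·C(f, δ+1) = (f−δ)·C(f, δ) ≥ (h'+2)·C(f, δ)`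
          have hf : h' + 1 + 1 + δ ≤ f i := by omega
          nlinarith [key, Nat.zero_le ((f i).choose δ)]
      · have hA' : ¬ (l ≤ x i ∧ x i ≤ h' ∧ l + h' + (δ + 1) ≤ f i + x i) := by omega
        rw [if_neg hA, if_neg hA', mul_zero, mul_zero, zero_add, add_zero]
        by_cases hB : l + (δ + 1) ≤ f i ∧ f i ≤ h' + (δ + 1)
        · have hB' : l + 1 + δ ≤ f i ∧ f i ≤ h' + 1 + δ := by omega
          rw [if_pos hB, if_pos hB']
          -- here `f i ≤ h' + δ + 1`, so `(δ+1)·C(f, δ+1) = (f−δ)·C(f, δ) ≤ (h'+1)·C(f, δ)`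
          have hf : f i ≤ h' + 1 + δ := by omega
          nlinarith [key, Nat.zero_le ((f i).choose δ)]
        · have hB' : ¬ (l + 1 + δ ≤ f i ∧ f i ≤ h' + 1 + δ) := by omega
          rw [if_neg hB, if_neg hB']
          simp
    have hsum := Finset.sum_le_sum hterm
    rw [Finset.sum_add_distrib, Finset.sum_add_distrib, ← Finset.mul_sum, ← Finset.mul_sum, ← Finset.mul_sum,
      ← Finset.mul_sum] at hsum
    have := Nat.mul_le_mul_left (δ + 1) hi'
    have hfin : (h' + 1 + 1) * ∑ i ∈ s, (if l + 1 ≤ x i + 1 ∧ x i + 1 ≤ h' + 1 ∧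
        l + 1 + (h' + 1) + δ ≤ f i + (x i + 1) then (f i).choose δ else 0) ≤
        (h' + 1 + 1) * ∑ i ∈ s, (if l + 1 + δ ≤ f i ∧ f i ≤ h' + 1 + δ then (f i).choose δ else 0) := by
      linarith
    exact Nat.le_of_mul_le_mul_left hfin (Nat.succ_pos _)

/-- THE (1,1)-SHIFT: the pairs `(x+1, f+1)` satisfy the (PLD) inequality at every admissible parameter. -/
theorem shift11 (s : Finset ι) (x f : ι → ℕ)
    (h : ∀ lo hi δ Θ : ℕ, Θ ≤ lo + hi + δ → (lo = 0 ∨ lo + hi + δ ≤ Θ) →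
      ∑ i ∈ s, (if lo ≤ x i ∧ x i ≤ hi ∧ Θ ≤ f i + x i then (f i).choose δ else 0) ≤
        ∑ i ∈ s, (if lo + δ ≤ f i ∧ f i ≤ hi + δ then (f i).choose δ else 0))
    (lo hi δ Θ : ℕ) (hΘ : Θ ≤ lo + hi + δ) (hlo : lo = 0 ∨ lo + hi + δ ≤ Θ) :
    ∑ i ∈ s, (if lo ≤ x i + 1 ∧ x i + 1 ≤ hi ∧ Θ ≤ (f i + 1) + (x i + 1) then (f i + 1).choose δ else 0) ≤
      ∑ i ∈ s, (if lo + δ ≤ f i + 1 ∧ f i + 1 ≤ hi + δ then (f i + 1).choose δ else 0) := by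
  rcases Nat.eq_zero_or_pos hi with hhi | hhi
  · -- `hi = 0`: the left window is empty
    subst hhi
    refine le_trans (le_of_eq (Finset.sum_eq_zero fun i _ => ?_)) (Nat.zero_le _)
    rw [if_neg (by omega)]
  obtain ⟨h', rfl⟩ : ∃ h', hi = h' + 1 := ⟨hi - 1, by omega⟩
  -- the matched instance `(lo−1, h', δ, Θ−2)`
  have hadm1 : Θ - 2 ≤ lo - 1 + h' + δ := by omega
  have hadm2 : lo - 1 = 0 ∨ lo - 1 + h' + δ ≤ Θ - 2 := by omega
  cases δ with
  | zero =>
    have h0 := h (lo - 1) h' 0 (Θ - 2) hadm1 hadm2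
    simp only [Nat.choose_zero_right] at h0 ⊢
    refine le_trans (le_of_eq (Finset.sum_congr rfl fun i _ => ?_))
      (le_trans h0 (Finset.sum_le_sum fun i _ => ?_))
    · split_ifs <;> omega
    · split_ifs <;> omega
  | succ d =>
    -- Pascal: `C(f+1, d+1) = C(f, d+1) + C(f, d)`; the `C(f, d+1)` part is the matched instance, the `C(f, d)` part is
    -- `shift10` at level `d` and threshold `Θ−1`
    have hsplit : ∀ i ∈ s,
        (if lo ≤ x i + 1 ∧ x i + 1 ≤ h' + 1 ∧ Θ ≤ (f i + 1) + (x i + 1) then (f i + 1).choose (d + 1) else 0) =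
          (if lo - 1 ≤ x i ∧ x i ≤ h' ∧ Θ - 2 ≤ f i + x i then (f i).choose (d + 1) else 0) +
          (if lo ≤ x i + 1 ∧ x i + 1 ≤ h' + 1 ∧ Θ - 1 ≤ f i + (x i + 1) then (f i).choose d else 0) := by
      intro i _
      rw [Nat.choose_succ_succ']
      split_ifs <;> omega
    have hsplitR : ∀ i ∈ s,
        (if lo + (d + 1) ≤ f i + 1 ∧ f i + 1 ≤ h' + 1 + (d + 1) then (f i + 1).choose (d + 1) else 0) =
          (if lo - 1 + (d + 1) ≤ f i ∧ f i ≤ h' + (d + 1) then (f i).choose (d + 1) else 0) +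
          (if lo + d ≤ f i ∧ f i ≤ h' + 1 + d then (f i).choose d else 0) +
          (if lo = 0 ∧ f i = d then (f i).choose (d + 1) else 0) := by
      intro i _
      rw [Nat.choose_succ_succ']
      split_ifs <;> omega
    rw [Finset.sum_congr rfl hsplit, Finset.sum_congr rfl hsplitR, Finset.sum_add_distrib, Finset.sum_add_distrib,
      Finset.sum_add_distrib]
    have h1 := h (lo - 1) h' (d + 1) (Θ - 2) hadm1 hadm2
    have h2 := shift10 s x f h lo (h' + 1) d (Θ - 1) (by omega) (by omega)
    have h3 : 0 ≤ ∑ i ∈ s, (if lo = 0 ∧ f i = d then (f i).choose (d + 1) else 0) := Nat.zero_le _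
    omega

/-- THE COLOOP: the pairs `(x, f+1)` and `(x+1, f)` together satisfy the (PLD) inequality at every admissible parameter. -/
theorem coloop (s : Finset ι) (x f : ι → ℕ)
    (h : ∀ lo hi δ Θ : ℕ, Θ ≤ lo + hi + δ → (lo = 0 ∨ lo + hi + δ ≤ Θ) →
      ∑ i ∈ s, (if lo ≤ x i ∧ x i ≤ hi ∧ Θ ≤ f i + x i then (f i).choose δ else 0) ≤
        ∑ i ∈ s, (if lo + δ ≤ f i ∧ f i ≤ hi + δ then (f i).choose δ else 0))
    (lo hi δ Θ : ℕ) (hΘ : Θ ≤ lo + hi + δ) (hlo : lo = 0 ∨ lo + hi + δ ≤ Θ) :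
    ∑ i ∈ s, ((if lo ≤ x i ∧ x i ≤ hi ∧ Θ ≤ (f i + 1) + x i then (f i + 1).choose δ else 0) +
        (if lo ≤ x i + 1 ∧ x i + 1 ≤ hi ∧ Θ ≤ f i + (x i + 1) then (f i).choose δ else 0)) ≤
      ∑ i ∈ s, ((if lo + δ ≤ f i + 1 ∧ f i + 1 ≤ hi + δ then (f i + 1).choose δ else 0) +
        (if lo + δ ≤ f i ∧ f i ≤ hi + δ then (f i).choose δ else 0)) := by
  rcases Nat.lt_or_ge hi lo with hhl | hhl
  · -- the left windows are empty
    refine le_trans (le_of_eq (Finset.sum_eq_zero fun i _ => ?_)) (Nat.zero_le _)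
    rw [if_neg (by omega), if_neg (by omega)]
    rfl
  -- the two instances of the window identity: `(lo−1, hi, δ', Θ−1)` and `(lo, hi−1, δ', Θ−1)`
  have hadmA1 : Θ - 1 ≤ lo - 1 + hi + δ := by omega
  have hadmA2 : lo - 1 = 0 ∨ lo - 1 + hi + δ ≤ Θ - 1 := by omega
  cases δ with
  | zero =>
    simp only [Nat.choose_zero_right]
    -- window identity on the left and on the right, termwise
    have hL : ∀ i ∈ s,
        ((if lo ≤ x i ∧ x i ≤ hi ∧ Θ ≤ (f i + 1) + x i then 1 else 0) +
          (if lo ≤ x i + 1 ∧ x i + 1 ≤ hi ∧ Θ ≤ f i + (x i + 1) then 1 else 0) : ℕ) =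
        (if lo - 1 ≤ x i ∧ x i ≤ hi ∧ Θ - 1 ≤ f i + x i then 1 else 0) +
          (if lo ≤ x i ∧ x i + 1 ≤ hi ∧ Θ - 1 ≤ f i + x i then 1 else 0) := by
      intro i _
      split_ifs <;> omega
    have hR : ∀ i ∈ s,
        ((if lo + 0 ≤ f i + 1 ∧ f i + 1 ≤ hi + 0 then 1 else 0) +
          (if lo + 0 ≤ f i ∧ f i ≤ hi + 0 then 1 else 0) : ℕ) =
        (if lo - 1 + 0 ≤ f i ∧ f i ≤ hi + 0 then 1 else 0) +
          (if lo + 0 ≤ f i ∧ f i + 1 ≤ hi + 0 then 1 else 0) := by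
      intro i _
      split_ifs <;> omega
    rw [Finset.sum_congr rfl hL, Finset.sum_congr rfl hR, Finset.sum_add_distrib, Finset.sum_add_distrib]
    have h1 := h (lo - 1) hi 0 (Θ - 1) hadmA1 hadmA2
    simp only [Nat.choose_zero_right] at h1
    -- the second window `[lo, hi−1]`: empty when `hi = 0`
    have h2 : ∑ i ∈ s, (if lo ≤ x i ∧ x i + 1 ≤ hi ∧ Θ - 1 ≤ f i + x i then 1 else 0) ≤
        ∑ i ∈ s, (if lo + 0 ≤ f i ∧ f i + 1 ≤ hi + 0 then 1 else 0) := by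
      rcases Nat.eq_zero_or_pos hi with hhi | hhi
      · subst hhi
        refine le_trans (le_of_eq (Finset.sum_eq_zero fun i _ => ?_)) (Nat.zero_le _)
        rw [if_neg (by omega)]
      · obtain ⟨h', rfl⟩ : ∃ h', hi = h' + 1 := ⟨hi - 1, by omega⟩
        have h2' := h lo h' 0 (Θ - 1) (by omega) (by omega)
        simp only [Nat.choose_zero_right] at h2'
        refine le_trans (le_of_eq (Finset.sum_congr rfl fun i _ => ?_))
          (le_trans h2' (le_of_eq (Finset.sum_congr rfl fun i _ => ?_)))
        · split_ifs <;> omega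
        · split_ifs <;> omega
    omega
  | succ d =>
    -- Pascal on `C(f+1, d+1)`: the `C(f, d)` part is the instance `(lo, hi, d, Θ−1)`; the `C(f, d+1)` parts re-pair
    -- through the window identity into `(lo−1, hi, d+1, Θ−1)` and `(lo, hi−1, d+1, Θ−1)`
    have hL : ∀ i ∈ s,
        ((if lo ≤ x i ∧ x i ≤ hi ∧ Θ ≤ (f i + 1) + x i then (f i + 1).choose (d + 1) else 0) +
          (if lo ≤ x i + 1 ∧ x i + 1 ≤ hi ∧ Θ ≤ f i + (x i + 1) then (f i).choose (d + 1) else 0)) =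
        (if lo ≤ x i ∧ x i ≤ hi ∧ Θ - 1 ≤ f i + x i then (f i).choose d else 0) +
          ((if lo - 1 ≤ x i ∧ x i ≤ hi ∧ Θ - 1 ≤ f i + x i then (f i).choose (d + 1) else 0) +
            (if lo ≤ x i ∧ x i + 1 ≤ hi ∧ Θ - 1 ≤ f i + x i then (f i).choose (d + 1) else 0)) := by
      intro i _
      rw [Nat.choose_succ_succ']
      split_ifs <;> omega
    have hR : ∀ i ∈ s,
        ((if lo + (d + 1) ≤ f i + 1 ∧ f i + 1 ≤ hi + (d + 1) then (f i + 1).choose (d + 1) else 0) +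
          (if lo + (d + 1) ≤ f i ∧ f i ≤ hi + (d + 1) then (f i).choose (d + 1) else 0)) =
        (if lo + d ≤ f i ∧ f i ≤ hi + d then (f i).choose d else 0) +
          ((if lo - 1 + (d + 1) ≤ f i ∧ f i ≤ hi + (d + 1) then (f i).choose (d + 1) else 0) +
            (if lo + (d + 1) ≤ f i ∧ f i + 1 ≤ hi + (d + 1) then (f i).choose (d + 1) else 0)) +
          (if lo = 0 ∧ f i = d then (f i).choose (d + 1) else 0) := by
      intro i _
      rw [Nat.choose_succ_succ']
      split_ifs <;> omega
    rw [Finset.sum_congr rfl hL, Finset.sum_congr rfl hR, Finset.sum_add_distrib, Finset.sum_add_distrib,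
      Finset.sum_add_distrib, Finset.sum_add_distrib, Finset.sum_add_distrib]
    have h0 := h lo hi d (Θ - 1) (by omega) (by omega)
    have h1 := h (lo - 1) hi (d + 1) (Θ - 1) hadmA1 hadmA2
    have h2 : ∑ i ∈ s, (if lo ≤ x i ∧ x i + 1 ≤ hi ∧ Θ - 1 ≤ f i + x i then (f i).choose (d + 1) else 0) ≤
        ∑ i ∈ s, (if lo + (d + 1) ≤ f i ∧ f i + 1 ≤ hi + (d + 1) then (f i).choose (d + 1) else 0) := by
      rcases Nat.eq_zero_or_pos hi with hhi | hhi
      · subst hhi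
        refine le_trans (le_of_eq (Finset.sum_eq_zero fun i _ => ?_)) (Nat.zero_le _)
        rw [if_neg (by omega)]
      · obtain ⟨h', rfl⟩ : ∃ h', hi = h' + 1 := ⟨hi - 1, by omega⟩
        have h2' := h lo h' (d + 1) (Θ - 1) (by omega) (by omega)
        refine le_trans (le_of_eq (Finset.sum_congr rfl fun i _ => ?_))
          (le_trans h2' (le_of_eq (Finset.sum_congr rfl fun i _ => ?_)))
        · split_ifs <;> omega
        · split_ifs <;> omega
    have h3 : 0 ≤ ∑ i ∈ s, (if lo = 0 ∧ f i = d then (f i).choose (d + 1) else 0) := Nat.zero_le _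
    omega

end PLDClosure

end PercRepro
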